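import Literature.Computability.MetaComplexity.ResLinProverDelayer
import Literature.Computability.MetaComplexity.ResLinSpace
import Literature.Computability.MetaComplexity.ResLinResolventImplication
import HarnessLib

/-!
# Extensible formulas: tree-like size and clause space lower bounds for Res(⊕) (Gryaznov–Ovcharov–Riazanov 2024, §3)

Gryaznov–Ovcharov–Riazanov [ACM ToCT 16(3) 2024, §3] isolate the semantic property of a CNF behind
the Itsykson–Sokolov tree-like lower bound for the pigeonhole principle. Fix an unsatisfiable CNF
`φ` and a set `F` of ("short") clauses. An assignment is `F`-PROPER if it satisfies every clause of
`F` (`IsFProper`). The formula `φ` is `m`-EXTENSIBLE w.r.t. `F` (`IsExtensible φ F m`) if every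
linear system over `𝔽₂` with fewer than `m` equations that has an `F`-proper solution has, for
every clause `C ∈ φ ∖ F`, an `F`-proper solution satisfying `C`.

* **Theorem 1** (`two_pow_le_length_of_isExtensible`): if `φ` is `m`-extensible w.r.t. `F` (and
  some `F`-proper assignment exists), every TREE-LIKE Res(⊕) refutation of `φ` has `≥ 2^m` lines.
  Proof as printed: the Delayer strategy "answer the value forced on all `F`-proper solutions of
  the board, otherwise `*`" (`extDelayer`) keeps an `F`-proper solution on the board
  (`exists_proper_sol_of_conform`); every `F`-proper solution of the STARRED sub-system solves the
  whole board (`sol_of_sol_starred`); so a board contradicting a clause of `φ ∖ F` carries `≥ m`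
  starred equations by extensibility, and a clause of `F` is never contradicted — then the
  Prover–Delayer lemma (`ResLinProverDelayer.lean`).
* **Theorem 2** (`le_resLinClauseSpace_of_isExtensible`): under the same hypotheses every
  configuration-style Res(⊕) refutation of `φ` (`ResLinSpace.lean`: download / erase / one
  inference, semantic weakening) has clause space `≥ m`. Proof as printed: maintain an `F`-proper
  assignment satisfying the memory; at a download of `C ∈ φ ∖ F` with `k < m` clauses in memory,
  pick one satisfied literal per clause and extend that `k`-equation system to satisfy `C`.

Difference from print (stated, not hidden): both theorems carry the hypothesis "some `F`-proper
assignment exists" (`∃ σ, IsFProper F σ`). It is implicit in the printed proofs (the base of both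
inductions) and the printed statements are false without it: for `F = φ` unsatisfiable, `φ` is
vacuously `m`-extensible for every `m`. `F ⊆ φ` is not needed and not assumed. Systems are lists of
equations (repetitions allowed; "fewer than `m` equations" = length `< m`, which only weakens the
hypothesis of extensibility to the printed one up to removing duplicates — every list of length
`< m` is a system of `< m` equations).

Applications: `PigeonholeResLinTreeLike.lean` (`PHPᵐₙ` is extensible w.r.t. its hole clauses —
GOR Lemma 2 / Thm 3, after Itsykson–Sokolov 2014 Lemma 3).

## References

* S. Gryaznov, S. Ovcharov, A. Riazanov, *Resolution over linear equations: combinatorial games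
  for tree-like size and space*, ACM Trans. Comput. Theory 16(3) (2024) = arXiv:2404.08370, §3
  (`m`-extensible formulas, Theorems 1 and 2) [GryaznovOvcharovRiazanov2024].
* D. Itsykson, D. Sokolov, MFCS 2014 §4 (Lemma 3, Theorem 4) / Ann. Pure Appl. Logic 2020
  [ItsyksonSokolov2020].
-/

namespace Literature.Computability.MetaComplexity

open _root_.Computability Complexity ProverDelayer

/-! ### Proper assignments and extensible formulas -/

/-- An assignment is `F`-PROPER if it satisfies every clause of the set `F` (the "short" clauses,
e.g. the hole axioms of `PHP`). [Gryaznov–Ovcharov–Riazanov 2024, §3 ("`F`-proper solution")]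
[cite: GryaznovOvcharovRiazanov2024, §3] -/
def IsFProper (F : Set (Clause ℕ)) (σ : ℕ → Bool) : Prop :=
  ∀ c ∈ F, Clause.eval σ c = true

/-- **`φ` is `m`-extensible w.r.t. `F`** [Gryaznov–Ovcharov–Riazanov 2024, §3]: for every linear
system over `𝔽₂` with fewer than `m` equations (a list `Φ` of equations `(f, a)`) which has an
`F`-proper solution, and every clause `C ∈ φ ∖ F`, there is an `F`-proper solution of `Φ` that
satisfies `C`. [cite: GryaznovOvcharovRiazanov2024, §3 (definition of m-extensible)] -/
def IsExtensible (φ : CNF ℕ) (F : Set (Clause ℕ)) (m : ℕ) : Prop :=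
  ∀ Φ : List LinLit, Φ.length < m →
    (∃ σ : ℕ → Bool, IsFProper F σ ∧ ∀ e ∈ Φ, LinLit.eval σ e = true) →
    ∀ c ∈ φ, c ∉ F →
      ∃ τ : ℕ → Bool, IsFProper F τ ∧ (∀ e ∈ Φ, LinLit.eval τ e = true) ∧ Clause.eval τ c = true

/-- Extensibility is antitone in `m`. [folklore] -/
theorem IsExtensible.mono {φ : CNF ℕ} {F : Set (Clause ℕ)} {m m' : ℕ} (h : IsExtensible φ F m)
    (hm : m' ≤ m) : IsExtensible φ F m' :=
  fun Φ hΦ hsol c hc hcF => h Φ (lt_of_lt_of_le hΦ hm) hsol c hc hcF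

/-! ### Theorem 1: the Delayer strategy of an extensible formula -/

section Delayer

variable (F : Set (Clause ℕ))

/-- The value of `f` is FORCED to `a` on the board `Φ`: every `F`-proper solution of `Φ` satisfies
`f = a`. [Gryaznov–Ovcharov–Riazanov 2024, Thm 1 (proof: "`g(x) = α` is implied by all `F`-proper
solutions of `Φ`")] [cite: GryaznovOvcharovRiazanov2024, Theorem 1] -/
def Forced (Φ : List LinLit) (f : Finset ℕ) (a : Bool) : Prop :=
  ∀ σ : ℕ → Bool, IsFProper F σ → (∀ e ∈ Φ, LinLit.eval σ e = true) → LinLit.eval σ (f, a) = true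

/-- **The Delayer of an extensible formula** [Gryaznov–Ovcharov–Riazanov 2024, Thm 1 (proof)]:
answer the value forced on all `F`-proper solutions of the board if there is one, otherwise `*`.
[cite: GryaznovOvcharovRiazanov2024, Theorem 1] -/
noncomputable def extDelayer : Strategy := fun Φ f => by
  classical
  exact if Forced F Φ f false then some false else if Forced F Φ f true then some true else none

variable {F}

/-- When the Delayer answers `a`, the value `a` is forced. [Gryaznov–Ovcharov–Riazanov 2024,
Thm 1 (proof)] [cite: GryaznovOvcharovRiazanov2024, Theorem 1] -/
theorem forced_of_extDelayer_eq_some {Φ : List LinLit} {f : Finset ℕ} {a : Bool}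
    (h : extDelayer F Φ f = some a) : Forced F Φ f a := by
  classical
  unfold extDelayer at h
  by_cases h0 : Forced F Φ f false
  · simp only [h0, if_true, Option.some.injEq] at h; subst h; exact h0
  · by_cases h1 : Forced F Φ f true
    · simp only [h0, if_false, h1, if_true, Option.some.injEq] at h; subst h; exact h1
    · simp [h0, h1] at h

/-- When the Delayer answers `*`, neither value is forced. [Gryaznov–Ovcharov–Riazanov 2024,
Thm 1 (proof)] [cite: GryaznovOvcharovRiazanov2024, Theorem 1] -/
theorem not_forced_of_extDelayer_eq_none {Φ : List LinLit} {f : Finset ℕ}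
    (h : extDelayer F Φ f = none) (a : Bool) : ¬ Forced F Φ f a := by
  classical
  unfold extDelayer at h
  by_cases h0 : Forced F Φ f false
  · simp [h0] at h
  · by_cases h1 : Forced F Φ f true
    · simp [h0, h1] at h
    · cases a
      · exact h0
      · exact h1

/-- If `f = ¬a` is not forced, some `F`-proper solution of the board satisfies `f = a`. [folklore] -/
theorem exists_proper_sol_cons_of_not_forced {Φ : List LinLit} {f : Finset ℕ} {a : Bool}
    (h : ¬ Forced F Φ f (!a)) :
    ∃ σ : ℕ → Bool, IsFProper F σ ∧ ∀ e ∈ (f, a) :: Φ, LinLit.eval σ e = true := by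
  unfold Forced at h
  push Not at h
  obtain ⟨σ, hσF, hσΦ, hne⟩ := h
  refine ⟨σ, hσF, ?_⟩
  intro e he
  rcases List.mem_cons.1 he with rfl | he
  · have := linLit_eval_not σ f a
    rw [this] at hne
    revert hne; cases LinLit.eval σ (f, a) <;> simp
  · exact hσΦ e he

/-- **Invariant** [Gryaznov–Ovcharov–Riazanov 2024, Thm 1 (proof: "the system `Φ` has an
`F`-proper solution")]: every board conforming to the Delayer of `F` has an `F`-proper solution,
provided some `F`-proper assignment exists at all. [cite: GryaznovOvcharovRiazanov2024, Theorem 1] -/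
theorem exists_proper_sol_of_conform (hF : ∃ σ : ℕ → Bool, IsFProper F σ) :
    ∀ Φ : List LinLit, Conform (extDelayer F) Φ →
      ∃ σ : ℕ → Bool, IsFProper F σ ∧ ∀ e ∈ Φ, LinLit.eval σ e = true := by
  intro Φ
  induction Φ with
  | nil =>
    intro _
    obtain ⟨σ, hσ⟩ := hF
    exact ⟨σ, hσ, by simp⟩
  | cons e Φ ih =>
    rintro ⟨hconf, hans⟩
    obtain ⟨σ, hσF, hσΦ⟩ := ih hconf
    obtain ⟨f, a⟩ := e
    rcases hans with hnone | hsome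
    · -- `*`: `f = ¬a` is not forced, so some proper solution has `f = a`
      exact exists_proper_sol_cons_of_not_forced (not_forced_of_extDelayer_eq_none hnone (!a))
    · -- answered `a`: forced on all proper solutions, in particular on `σ`
      have hforced := forced_of_extDelayer_eq_some hsome
      refine ⟨σ, hσF, ?_⟩
      intro e he
      rcases List.mem_cons.1 he with rfl | he
      · exact hforced σ hσF hσΦ
      · exact hσΦ e he

/-- The STARRED sub-board: the equations of `Φ` on which the strategy `δ` answered `*`.
[Gryaznov–Ovcharov–Riazanov 2024, Thm 1 (proof: "the linear system `Φ' ⊆ Φ` corresponding to the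
answers `*` of Delayer")] [cite: GryaznovOvcharovRiazanov2024, Theorem 1] -/
def starred (δ : Strategy) : List LinLit → List LinLit
  | [] => []
  | e :: Φ => if δ Φ e.1 = none then e :: starred δ Φ else starred δ Φ

/-- The starred sub-board has exactly `coins` equations. [folklore] -/
theorem length_starred (δ : Strategy) : ∀ Φ : List LinLit, (starred δ Φ).length = coins δ Φ := by
  intro Φ
  induction Φ with
  | nil => rfl
  | cons e Φ ih =>
    simp only [starred, coins_cons]
    split_ifs with h
    · simp [ih]
    · simp [ih]

/-- The starred sub-board is a sub-board. [folklore] -/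
theorem mem_of_mem_starred (δ : Strategy) : ∀ {Φ : List LinLit} {e : LinLit},
    e ∈ starred δ Φ → e ∈ Φ := by
  intro Φ
  induction Φ with
  | nil => intro e he; simp [starred] at he
  | cons e' Φ ih =>
    intro e he
    simp only [starred] at he
    split_ifs at he with h
    · rcases List.mem_cons.1 he with rfl | he
      · exact List.mem_cons_self
      · exact List.mem_cons_of_mem _ (ih he)
    · exact List.mem_cons_of_mem _ (ih he)

/-- **The non-starred equations are implied** [Gryaznov–Ovcharov–Riazanov 2024, Thm 1 (proof:
"the lines of `Φ ∖ Φ'` must be implied by all `F`-proper solutions of `Φ'`")]: every `F`-proper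
solution of the starred sub-board of a conforming board solves the whole board.
[cite: GryaznovOvcharovRiazanov2024, Theorem 1] -/
theorem sol_of_sol_starred : ∀ {Φ : List LinLit}, Conform (extDelayer F) Φ →
    ∀ {σ : ℕ → Bool}, IsFProper F σ → (∀ e ∈ starred (extDelayer F) Φ, LinLit.eval σ e = true) →
      ∀ e ∈ Φ, LinLit.eval σ e = true := by
  intro Φ
  induction Φ with
  | nil => intros; simp_all
  | cons e Φ ih =>
    rintro ⟨hconf, hans⟩ σ hσF hstar e' he'
    have hΦ : ∀ e ∈ Φ, LinLit.eval σ e = true := by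
      refine ih hconf hσF fun e he => hstar e ?_
      simp only [starred]
      split_ifs
      · exact List.mem_cons_of_mem _ he
      · exact he
    rcases List.mem_cons.1 he' with rfl | he'
    · rcases hans with hnone | hsome
      · apply hstar
        simp only [starred, hnone, if_true]
        exact List.mem_cons_self
      · exact forced_of_extDelayer_eq_some hsome σ hσF hΦ
    · exact hΦ e' he'

/-- **The Delayer of an `m`-extensible formula guarantees `m` coins**
[Gryaznov–Ovcharov–Riazanov 2024, Thm 1 (proof)]. [cite: GryaznovOvcharovRiazanov2024, Theorem 1] -/
theorem guarantees_extDelayer {φ : CNF ℕ} {m : ℕ} (hext : IsExtensible φ F m)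
    (hF : ∃ σ : ℕ → Bool, IsFProper F σ) : Guarantees φ (extDelayer F) m := by
  classical
  intro Φ hconf hend
  obtain ⟨c, hc, hcontra⟩ := hend
  obtain ⟨σ, hσF, hσΦ⟩ := exists_proper_sol_of_conform hF Φ hconf
  by_cases hcF : c ∈ F
  · -- a clause of `F` is satisfied by the proper solution `σ` of the board: never contradicted
    have h1 := hcontra σ hσΦ
    rw [eval_toLinClause] at h1
    have h2 := hσF c hcF
    simp only [Clause.eval] at h2
    rw [h2] at h1
    exact absurd h1 (by simp)
  · -- a clause outside `F`: the starred sub-board has `≥ m` equations by extensibility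
    by_contra hlt
    push Not at hlt
    rw [← length_starred] at hlt
    have hsol : ∃ σ : ℕ → Bool, IsFProper F σ ∧
        ∀ e ∈ starred (extDelayer F) Φ, LinLit.eval σ e = true :=
      ⟨σ, hσF, fun e he => hσΦ e (mem_of_mem_starred _ he)⟩
    obtain ⟨τ, hτF, hτS, hτc⟩ := hext _ hlt hsol c hc hcF
    have hτΦ := sol_of_sol_starred hconf hτF hτS
    have h1 := hcontra τ hτΦ
    rw [eval_toLinClause] at h1
    simp only [Clause.eval] at hτc
    rw [hτc] at h1
    exact absurd h1 (by simp)

end Delayer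

/-- **Theorem 1** [Gryaznov–Ovcharov–Riazanov 2024, Thm 1; Itsykson–Sokolov 2014 for `PHP`]: if
`φ` is `m`-extensible w.r.t. `F` and some `F`-proper assignment exists, then every TREE-LIKE
Res(⊕) refutation of `φ` (resolution rule + semantic weakening, every line used as a premise at
most once) has at least `2^m` lines. [cite: GryaznovOvcharovRiazanov2024, Theorem 1] -/
theorem two_pow_le_length_of_isExtensible {φ : CNF ℕ} {F : Set (Clause ℕ)} {m : ℕ}
    (hext : IsExtensible φ F m) (hF : ∃ σ : ℕ → Bool, IsFProper F σ) {π : List ResLinLine}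
    (hπ : IsResLinRefutation φ π) (htree : ∀ i : ℕ, (π.map fun l => l.premises.count i).sum ≤ 1) :
    2 ^ m ≤ π.length :=
  two_pow_le_length_of_guarantees (guarantees_extDelayer hext hF) hπ htree

/-! ### Theorem 2: clause space -/

/-- Chain induction with membership: a property holding at the head of an `R`-chain and preserved
along `R`-steps between members of the chain holds for all members. [folklore] -/
theorem forall_mem_of_isChain {α : Type*} {R : α → α → Prop} {P : α → Prop} :
    ∀ (l : List α), List.IsChain R l → (∀ a ∈ l, ∀ b ∈ l, R a b → P a → P b) →
      (∀ h : l ≠ [], P (l.head h)) → ∀ a ∈ l, P a := by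
  intro l
  induction l with
  | nil => intros; simp_all
  | cons a l ih =>
    intro hchain hstep hhead x hx
    have hPa : P a := hhead (by simp)
    rcases List.mem_cons.1 hx with rfl | hx
    · exact hPa
    · cases l with
      | nil => simp at hx
      | cons b l' =>
        rw [List.isChain_cons_cons] at hchain
        have hPb : P b := hstep a (by simp) b (by simp) hchain.1 hPa
        refine ih hchain.2 (fun a' ha' b' hb' => hstep a' (List.mem_cons_of_mem _ ha') b'
          (List.mem_cons_of_mem _ hb')) (fun _ => by simpa using hPb) x hx

/-- One memory operation preserves "some `F`-proper assignment satisfies the memory", as long as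
the memory before the step holds fewer than `m` clauses [Gryaznov–Ovcharov–Riazanov 2024, Thm 2
(proof: erase / inference by soundness; download of `C ∈ F` for free; download of `C ∈ φ ∖ F`:
one satisfied literal per clause in memory gives a system of `< m` equations with a proper
solution, extended to satisfy `C`)]. [cite: GryaznovOvcharovRiazanov2024, Theorem 2] -/
theorem ResLinSpaceStep.exists_proper_model {φ : CNF ℕ} {F : Set (Clause ℕ)} {m : ℕ}
    (hext : IsExtensible φ F m) {M M' : Finset LinClause} (hstep : ResLinSpaceStep φ M M')
    (hcard : M.card < m) (hM : ∃ σ : ℕ → Bool, IsFProper F σ ∧ ∀ C ∈ M, C.eval σ = true) :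
    ∃ σ : ℕ → Bool, IsFProper F σ ∧ ∀ C ∈ M', C.eval σ = true := by
  classical
  obtain ⟨σ, hσF, hσM⟩ := hM
  cases hstep with
  | download c hc =>
    by_cases hcF : c ∈ F
    · refine ⟨σ, hσF, ?_⟩
      intro C hC
      rcases Finset.mem_insert.1 hC with rfl | hC
      · rw [eval_toLinClause]; exact hσF c hcF
      · exact hσM C hC
    · -- one satisfied literal per clause in memory
      have hpick : ∀ C ∈ M, ∃ l ∈ C, LinLit.eval σ l = true := by
        intro C hC
        have := hσM C hC
        simpa [LinClause.eval] using this
      choose! pick hpick_mem hpick_eval using hpick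
      set Φ : List LinLit := M.toList.map pick with hΦ
      have hlen : Φ.length < m := by
        rw [hΦ, List.length_map, Finset.length_toList]; exact hcard
      have hsol : ∃ σ : ℕ → Bool, IsFProper F σ ∧ ∀ e ∈ Φ, LinLit.eval σ e = true := by
        refine ⟨σ, hσF, ?_⟩
        intro e he
        rw [hΦ, List.mem_map] at he
        obtain ⟨C, hC, rfl⟩ := he
        exact hpick_eval C (Finset.mem_toList.1 hC)
      obtain ⟨τ, hτF, hτΦ, hτc⟩ := hext Φ hlen hsol c hc hcF
      refine ⟨τ, hτF, ?_⟩
      intro C hC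
      rcases Finset.mem_insert.1 hC with rfl | hC
      · rw [eval_toLinClause]; exact hτc
      · exact linClause_eval_eq_true_of_mem (hpick_mem C hC)
          (hτΦ (pick C) (by rw [hΦ, List.mem_map]; exact ⟨C, Finset.mem_toList.2 hC, rfl⟩))
  | erase C hC =>
    exact ⟨σ, hσF, fun D hD => hσM D (Finset.mem_of_mem_erase hD)⟩
  | resolve C D f hC hD =>
    refine ⟨σ, hσF, ?_⟩
    intro E hE
    rcases Finset.mem_insert.1 hE with rfl | hE
    · have h0 := hσM _ hC
      have h1 := hσM _ hD
      rw [LinClause.eval_insert] at h0 h1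
      rw [LinClause.eval_union]
      rw [LinLit.eval_true_eq_not] at h1
      revert h0 h1
      cases LinLit.eval σ (f, false) <;> cases LinClause.eval σ C <;>
        cases LinClause.eval σ D <;> simp
    · exact hσM E hE
  | weaken C D hC h =>
    refine ⟨σ, hσF, ?_⟩
    intro E hE
    rcases Finset.mem_insert.1 hE with rfl | hE
    · exact h σ (hσM C hC)
    · exact hσM E hE

/-- **Theorem 2** [Gryaznov–Ovcharov–Riazanov 2024, Thm 2]: if `φ` is `m`-extensible w.r.t. `F`
and some `F`-proper assignment exists, then every configuration-style Res(⊕) refutation of `φ`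
keeps at least `m` linear clauses in memory at some moment (clause space `≥ m`).
[cite: GryaznovOvcharovRiazanov2024, Theorem 2] -/
theorem le_resLinClauseSpace_of_isExtensible {φ : CNF ℕ} {F : Set (Clause ℕ)} {m : ℕ}
    (hext : IsExtensible φ F m) (hF : ∃ σ : ℕ → Bool, IsFProper F σ)
    {π : List (Finset LinClause)} (hπ : IsResLinSpaceRefutation φ π) :
    m ≤ resLinClauseSpace π := by
  by_contra hlt
  push Not at hlt
  have hall : ∀ M ∈ π, M.card < m := fun M hM => (card_le_resLinClauseSpace hM).trans_lt hlt
  obtain ⟨hne, hhead, hchain, hlast⟩ := hπ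
  have key : ∀ M ∈ π, ∃ σ : ℕ → Bool, IsFProper F σ ∧ ∀ C ∈ M, C.eval σ = true := by
    refine forall_mem_of_isChain π hchain ?_ ?_
    · intro M hM M' _ hstep hPM
      exact hstep.exists_proper_model hext (hall M hM) hPM
    · intro h
      rw [show π.head h = π.head hne from rfl, hhead]
      obtain ⟨σ, hσ⟩ := hF
      exact ⟨σ, hσ, by simp⟩
  obtain ⟨σ, -, hσ⟩ := key _ (List.getLast_mem hne)
  have := hσ ∅ hlast
  simp [LinClause.eval] at this

/-- Theorem 2 in `ℕ∞` form: the Res(⊕) clause space of an `m`-extensible formula is `≥ m`.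
[Gryaznov–Ovcharov–Riazanov 2024, Thm 2] [cite: GryaznovOvcharovRiazanov2024, Theorem 2] -/
theorem le_minResLinClauseSpace_of_isExtensible {φ : CNF ℕ} {F : Set (Clause ℕ)} {m : ℕ}
    (hext : IsExtensible φ F m) (hF : ∃ σ : ℕ → Bool, IsFProper F σ) :
    (m : ℕ∞) ≤ minResLinClauseSpace φ :=
  le_minResLinClauseSpace_iff.2 fun _ hπ => le_resLinClauseSpace_of_isExtensible hext hF hπ

end Literature.Computability.MetaComplexity
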